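import Literature.MathematicalPhysics.QuantumFieldTheory.Balaban1983to89.B1Eq324BenfattoSect5LedgerDischargeLower
import Literature.MathematicalPhysics.QuantumFieldTheory.Balaban1983to89.B1Eq324BenfattoSect5BasicLemmaKnit
import HarnessLib

/-!
# Benfatto et al. 1978 — THE BASIC LEMMA p. 152 (4.5)–(4.7) AS PRINTED, PROVED; B1 (3.24) for [2]'s model, unconditional

doc: Literature/MathematicalPhysics/QuantumFieldTheory/Balaban1983to89/B1Eq324BenfattoLemma.md

This module closes the [BenfattoEtAl1978] chain behind [Balaban1982Higgs1] (3.24): the named fact `B1Eq324BenfattoLemma.BasicLemmaPrinted` — «the lemma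
formulated on p. 152» for `d = 2, 3` and the free field with `E z_Δ² = ½` — is a THEOREM (`basicLemmaPrinted_holds`), and so is the Lemma with recorded signs
for every `d ≥ 1`, `α, β > 0`, `E z_Δ² ≤ ½` (`basicLemma_signed`, `basicLemma_holds`), whence B1 (3.24) in `η`-currency at `t = 6` (d = 3) and `t = 4` (d = 2)
(`eq324_benfatto_seven/_five`, over `…Eq324Signed`).  It is the ≈ 40-line instantiation of the knit `…Sect5BasicLemmaKnit.basicLemma_signed_of_ledgers` at print's
contraction `γ = (2(1+2d/α²))⁻¹` ((5.14)–(5.15) p.155) with the ledger socket discharged by `…Sect5LedgerDischargeLower.lowerpack` and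
`…Sect5LedgerDischargeUpper.upperpack` at the common exponents `ρ₁ = ρ₃ = D + 2d`, `ρ₂ = 0`, `ρ₄ = 8·2^d·s₁(D)·γ^{−D(d+1)} + 1` and the threshold
`b* = max(b*_upper, b*_lower(b̄))` — print's «b* = max{10⁴, γ⁻³b̄}», p. 159.
[cite: BenfattoEtAl1978, Lemma (4.5)–(4.7) p.152, Remark 1; §5 pp.153–159; b* p.159; Appendix A p.161] [cite: Balaban1982Higgs1, (3.24) p.616]

## Theorems
* `gammaPrint_pos`, `gammaPrint_le_one`, `gammaPrint_mul_le` — print's contraction `γ = (2(1+2d/α²))⁻¹`.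
* ★★ `basicLemma_signed` — the Lemma p.152 with recorded signs `0 ≤ S`, `0 < ρ₃`, for `d ≥ 1`, `α, β > 0`, `E z_Δ² ≤ ½`.
* ★★ `basicLemma_holds` — `BasicLemma d α β` for the same free fields.
* ★★★ `basicLemmaPrinted_holds` — `BasicLemmaPrinted`.
* `eq324_benfatto_seven`, `eq324_benfatto_five` — [Balaban1982Higgs1] (3.24) for [2]'s model (t = 6, κ = 13/4; t = 4, κ = 9/4), unconditional.

HONEST SCOPE.  The identification of B1's / B10's fluctuation integrals with [2]'s model remains the (α)-row's business (header of `…Specialisation`);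
count-neutral for N08's node statement; nothing of [Balaban1985UV3] (41)/(47)/(5) is asserted; nothing about d = 4, the continuum, OS axioms, a mass gap or the
Clay problem.
-/

noncomputable section

namespace Literature.MathematicalPhysics.QuantumFieldTheory.Balaban1983to89.B1Eq324BenfattoSect5BasicLemma

open MeasureTheory Finset
open Literature.MathematicalPhysics.QuantumFieldTheory
open Literature.MathematicalPhysics.QuantumFieldTheory.Balaban1983to89.B1Eq324BenfattoLemma
open Literature.MathematicalPhysics.QuantumFieldTheory.Balaban1983to89.B1Eq324BenfattoSect5Eq511 (s1Const)
open Literature.MathematicalPhysics.QuantumFieldTheory.Balaban1983to89.B1Eq324BenfattoSect5ErrTermLedger (s1Const_nonneg)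
open Literature.MathematicalPhysics.QuantumFieldTheory.Balaban1983to89.B1Eq324BenfattoSect5BasicLemmaKnit (basicLemma_signed_of_ledgers)
open Literature.MathematicalPhysics.QuantumFieldTheory.Balaban1983to89.B1Eq324BenfattoSect5LedgerDischargeUpper (upperpack)
open Literature.MathematicalPhysics.QuantumFieldTheory.Balaban1983to89.B1Eq324BenfattoSect5LedgerDischargeLower (lowerpack)
open Literature.MathematicalPhysics.QuantumFieldTheory.Balaban1983to89.B1Eq324BenfattoEq324Signed

variable {d : ℕ} {α β : ℝ}

/-! ## §1  Print's contraction `γ = (2(1 + 2d/α²))⁻¹` -/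

/-- Print's contraction factor `γ = (2(1 + 2d/α²))⁻¹` ((5.14) p.155) is positive. [cite: BenfattoEtAl1978, (5.14) p.155] -/
theorem gammaPrint_pos (hα : 0 < α) : 0 < 1 / (2 * (1 + 2 * (d : ℝ) / α ^ 2)) := by positivity

/-- Print's contraction factor is at most `1`. [cite: BenfattoEtAl1978, (5.14) p.155] -/
theorem gammaPrint_le_one (hα : 0 < α) : 1 / (2 * (1 + 2 * (d : ℝ) / α ^ 2)) ≤ 1 := by
  have h : 0 ≤ 2 * (d : ℝ) / α ^ 2 := by positivity
  rw [div_le_one (by positivity)]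
  linarith

/-- Print's contraction factor satisfies `γ(1 + 2d/α²) ≤ ½` (with equality): the field transported to the next pavement stays small, (5.15).
[cite: BenfattoEtAl1978, (5.14)–(5.15) p.155] -/
theorem gammaPrint_mul_le (hα : 0 < α) : 1 / (2 * (1 + 2 * (d : ℝ) / α ^ 2)) * (1 + 2 * d / α ^ 2) ≤ 1 / 2 := by
  have h : 0 < 1 + 2 * (d : ℝ) / α ^ 2 := by positivity
  rw [div_mul_eq_mul_div, one_mul, div_le_iff₀ (by positivity)]
  linarith

/-! ## §2  The Lemma p. 152 -/

/-- ★★ **THE LEMMA OF p. 152 OF [BenfattoEtAl1978] WITH RECORDED SIGNS, PROVED**: for every `d ≥ 1` and every free field `(α, β)`, `α, β > 0`, with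
`E z_Δ² = G(0,0) ≤ ½`, there is a threshold `b*` such that for all `t, D` and `ϰ > 0` there are `S ≥ 0`, `ρ₁, ρ₂`, `ρ₃ > 0`, `ρ₄` with: for every `s`, every
`b > b*`, all regions `J ⊆ I`, `I ≠ ∅`, every coefficient family, (4.6) holds for every conditioning set `C` at distance `≥ b³` from `J` and all values `z̄`,
and (4.7) holds.  Instantiation of `basicLemma_signed_of_ledgers` at `γ = (2(1+2d/α²))⁻¹` with the socket discharged by `lowerpack` ∧ `upperpack` at
`ρ₁ = ρ₃ = D + 2d`, `ρ₂ = 0`, `ρ₄ = 8·2^d·s₁(D)·γ^{−D(d+1)} + 1`, `b* = max(b*_upper, b*_lower(b̄))`.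
[cite: BenfattoEtAl1978, Lemma (4.5)–(4.7) p.152; §5 pp.153–159; b* p.159] -/
theorem basicLemma_signed (hd : 0 < d) (hα : 0 < α) (hβ : 0 < β) (hvar : freeCov d α β 0 0 ≤ 1 / 2) :
    ∃ bstar : ℝ, ∀ (t D : ℕ) (ϰ : ℝ), 0 < ϰ → ∃ S ρ₁ ρ₂ ρ₃ ρ₄ : ℝ, 0 ≤ S ∧ 0 < ρ₃ ∧
      ∀ (s : ℕ) (b : ℝ), bstar < b → ∀ (I J : Finset (Fin d → ℤ)), I.Nonempty → J ⊆ I → ∀ a : Coef d,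
        (∀ (C : Finset (Fin d → ℤ)) (zbar : (Fin d → ℤ) → ℝ), (∀ x ∈ C, ∀ y ∈ J, b ^ 3 ≤ cubeDist x y) →
            Ineq46 d α β t D s ϰ S ρ₁ ρ₂ ρ₃ ρ₄ b I J C a zbar) ∧
          Ineq47 d α β t D s ϰ S ρ₁ ρ₂ ρ₃ ρ₄ b I J a := by
  set γ₀ : ℝ := 1 / (2 * (1 + 2 * (d : ℝ) / α ^ 2)) with hγ₀
  have hγ0 : 0 < γ₀ := gammaPrint_pos (d := d) hα
  have hγ1 : γ₀ ≤ 1 := gammaPrint_le_one (d := d) hα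
  have hγc : γ₀ * (1 + 2 * d / α ^ 2) ≤ 1 / 2 := gammaPrint_mul_le (d := d) hα
  have hd' : (0 : ℝ) < d := by exact_mod_cast hd
  refine basicLemma_signed_of_ledgers hα hβ hvar hd hγ0 hγ1 hγc fun bbar k₁ k₂ hk₁ hk₂ =>
    ⟨max (6 * 2 ^ d * ((d + 1).factorial : ℝ) * (4 / 1 ^ 2) ^ (d + 1) + 10 * (d + 1) + 2 * Real.sqrt d + 2)
      ((γ₀ ^ (d + 1))⁻¹ * (|bbar| + 1) + 6 * 2 ^ d * ((d + 1).factorial : ℝ) * (4 / (γ₀ ^ d) ^ 2) ^ (d + 1) + 10 * (d + 1) + 1),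
      fun t D ϰ hϰ => ?_⟩
  have hs1 : 0 ≤ s1Const D D d ϰ := s1Const_nonneg D D d hϰ.le
  have hΓ1 : (1 : ℝ) ≤ (γ₀ ^ (d + 1))⁻¹ := one_le_inv_iff₀.mpr ⟨pow_pos hγ0 _, pow_le_one₀ hγ0.le hγ1⟩
  have hρ₄ : 8 * s1Const D D d ϰ * 1 ^ D * 2 ^ d + 1 ≤ 8 * s1Const D D d ϰ * (γ₀ ^ (d + 1))⁻¹ ^ D * 2 ^ d + 1 := by
    have h1 : (1 : ℝ) ^ D ≤ (γ₀ ^ (d + 1))⁻¹ ^ D := by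
      rw [one_pow]; exact one_le_pow₀ hΓ1
    nlinarith [mul_le_mul_of_nonneg_left h1 (by positivity : (0 : ℝ) ≤ 8 * s1Const D D d ϰ * 2 ^ d)]
  exact ⟨(D : ℝ) + 2 * d, 0, (D : ℝ) + 2 * d, 8 * s1Const D D d ϰ * (γ₀ ^ (d + 1))⁻¹ ^ D * 2 ^ d + 1,
    by positivity,
    lowerpack hd hα hβ hγ0 hγ1 hk₁ hk₂ t D hϰ le_rfl le_rfl le_rfl hρ₄ (le_max_right _ _),
    upperpack hd hα hβ hγ0 hγ1 t D hϰ le_rfl le_rfl le_rfl le_rfl (le_max_left _ _)⟩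

/-- ★★ **THE BASIC LEMMA OF [BenfattoEtAl1978] for the free field `(d, α, β)`**, `d ≥ 1`, `α, β > 0`, `E z_Δ² ≤ ½`: `BasicLemma d α β`.
[cite: BenfattoEtAl1978, Lemma (4.5)–(4.7) p.152; §5 pp.153–159] -/
theorem basicLemma_holds (hd : 0 < d) (hα : 0 < α) (hβ : 0 < β) (hvar : freeCov d α β 0 0 ≤ 1 / 2) : BasicLemma d α β :=
  basicLemma_of_signed (basicLemma_signed hd hα hβ hvar)

/-- ★★★ **THE LEMMA FORMULATED ON p. 152 OF [BenfattoEtAl1978], AS PRINTED, IS A THEOREM**: `BasicLemmaPrinted` — for `d = 2, 3` and the free field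
(1.1) with `α, β > 0` normalised to `E z_Δ² = ½`, the Basic Lemma (4.5)–(4.7) holds.  This is the result [Balaban1982Higgs1] p. 616 invokes for (3.24) and,
through [8] = B1, [Balaban1985UV3] (24) p. 262 / (58) p. 270. [cite: BenfattoEtAl1978, Lemma p.152 (4.5)–(4.7), Remark 1; §5 «Proof of the basic Lemma» pp.153–159] -/
theorem basicLemmaPrinted_holds : BasicLemmaPrinted :=
  basicLemmaPrinted_of_signed fun _d hd _α _β hα hβ hE =>
    basicLemma_signed (by rcases hd with rfl | rfl <;> norm_num) hα hβ hE.le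

/-! ## §3  B1 (3.24) for [2]'s model, unconditional -/

/-- **[Balaban1982Higgs1] (3.24) p. 616 for [2]'s model — d = 3 instance (`t = 6`, coefficients `∝ η^{1/2}`, rate `η^{13/4}`), UNCONDITIONAL**: for every
free field `(d, α, β)` with `d ≥ 1`, `E z_Δ² ≤ ½`, every `D`, `ϰ > 0`, threshold data `b₀ > 0`, `p₀ > 2/3` and `c ≥ 0` there are `η₀ ∈ (0,1]`, `C ≥ 0` with, for all
`η ≤ η₀`, all `s`, `I ⊇ J ≠ ∅`-data and coefficient families with `sup|coeff| ≤ c·η^{1/2}`: the cut-off Boltzmann integral is positive and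
`|log ∫Π_Δχ̂_{p(η)}e^{H_J}dP̂₀ − Σ_{k≤6} ℰ̂₀ᵀ(H_J;k)/k!| ≤ C·η^{13/4}·|I|`. [cite: Balaban1982Higgs1, (3.24) p.616; BenfattoEtAl1978, Lemma p.152, Remark 4] -/
theorem eq324_benfatto_seven (hd : 0 < d) (hα : 0 < α) (hβ : 0 < β) (hvar : freeCov d α β 0 0 ≤ 1 / 2)
    (D : ℕ) {ϰ : ℝ} (hϰ : 0 < ϰ) {b₀ p₀ c : ℝ} (hb₀ : 0 < b₀) (hp₀ : 2 / 3 < p₀) (hc : 0 ≤ c) :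
    ∃ η₀ C : ℝ, 0 < η₀ ∧ η₀ ≤ 1 ∧ 0 ≤ C ∧ ∀ η : ℝ, 0 < η → η ≤ η₀ →
      ∀ (s : ℕ) (I J : Finset (Fin d → ℤ)) (a : Coef d), I.Nonempty → J ⊆ I →
        coefSup s D a J ≤ c * η ^ (1 / 2 : ℝ) →
        0 < ∫ z, cutoffBoltzmann (hamiltonian s D ϰ a J) I (B10.pFun b₀ p₀ η) z ∂P0 d α β ∧
          |Real.log (∫ z, cutoffBoltzmann (hamiltonian s D ϰ a J) I (B10.pFun b₀ p₀ η) z ∂P0 d α β) -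
              cumulantSum (P0 d α β) (hamiltonian s D ϰ a J) 6| ≤ C * η ^ (13 / 4 : ℝ) * I.card :=
  eq324_of_basicLemma_signed_seven (basicLemma_signed hd hα hβ hvar) D hϰ hb₀ hp₀ hc

/-- **[Balaban1982Higgs1] (3.24) for [2]'s model — d = 2 instance (`t = 4`, rate `η^{9/4}`), UNCONDITIONAL.**
[cite: Balaban1982Higgs1, (3.24) p.616; BenfattoEtAl1978, Lemma p.152, Remark 4] -/
theorem eq324_benfatto_five (hd : 0 < d) (hα : 0 < α) (hβ : 0 < β) (hvar : freeCov d α β 0 0 ≤ 1 / 2)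
    (D : ℕ) {ϰ : ℝ} (hϰ : 0 < ϰ) {b₀ p₀ c : ℝ} (hb₀ : 0 < b₀) (hp₀ : 2 / 3 < p₀) (hc : 0 ≤ c) :
    ∃ η₀ C : ℝ, 0 < η₀ ∧ η₀ ≤ 1 ∧ 0 ≤ C ∧ ∀ η : ℝ, 0 < η → η ≤ η₀ →
      ∀ (s : ℕ) (I J : Finset (Fin d → ℤ)) (a : Coef d), I.Nonempty → J ⊆ I →
        coefSup s D a J ≤ c * η ^ (1 / 2 : ℝ) →
        0 < ∫ z, cutoffBoltzmann (hamiltonian s D ϰ a J) I (B10.pFun b₀ p₀ η) z ∂P0 d α β ∧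
          |Real.log (∫ z, cutoffBoltzmann (hamiltonian s D ϰ a J) I (B10.pFun b₀ p₀ η) z ∂P0 d α β) -
              cumulantSum (P0 d α β) (hamiltonian s D ϰ a J) 4| ≤ C * η ^ (9 / 4 : ℝ) * I.card :=
  eq324_of_basicLemma_signed_five (basicLemma_signed hd hα hβ hvar) D hϰ hb₀ hp₀ hc

end Literature.MathematicalPhysics.QuantumFieldTheory.Balaban1983to89.B1Eq324BenfattoSect5BasicLemma

end
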